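import Mathlib
import Literature.Analysis.FluidPDE.CheskidovFriedlander2009.InviscidCriticalBlowup
import Literature.Analysis.FluidPDE.CheskidovFriedlander2009.Reduction
import HarnessLib

/-!
# The inviscid dyadic attractor and the anomalous dissipation rate for every `λ = 2^c < 2³`
# (Cheskidov–Friedlander–Pavlović 2010 Thm. 4.4 "qualitatively independent of `λ`";
# Cheskidov–Friedlander 2009 Thm. 4.1 in its printed range `c ∈ (3/2, 5/2]`) — PROVED

A. Cheskidov, S. Friedlander, N. Pavlović, DCDS 26 (2010) 781–794 = arXiv:math/0610815v1: §4 is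
written for `λ = 2^{5/2}`, with (Notation, p. 3) "we adopt `λ^j` as the scaling parameter … to
illustrate that the results are qualitatively independent of the exact choice of `λ` … The proofs
of results in section 4 require `λ < 2³`."  A. Cheskidov, S. Friedlander, Physica D 238 (2009)
783–787, Thm. 4.1 p. 9, states the inviscid anomalous dissipation rate for `c ∈ (3/2, 5/2]`
("proved in [CFP]").  The tree's `InviscidAttractor.lean` discharges Thm. 4.4 at `c = 5/2` (the
typed fact) and derives Thm. 4.1 there.  This file runs the SAME proof for every `0 < c < 3`
(`λ = 2^c ∈ (1, 8)`): the algebra of `InviscidAttractor.lean` (`inviscid_pert_le`,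
`inviscid_pert_le_two_levels`, `sum_sq_le_dSeq`, …) is already stated for any `s` with `2^c = s³`,
`sq = 1`, and the Gronwall packaging `IsSolution.normSq_exp_decay_of_trunc` for any parameters; only
the constants change — `s = λ^{1/3} = 2^{c/3} ∈ (1,2)`, `q = 2^{−c/3}`, `K = 2^{c/6}√f₀`
(`inviscidFixedPoint c f₀ j = Kq^j` definitionally), `θ = (2 − s)/2`, `S = Σ_j(j+1)q^{2j}`
(`CFPc.*`) — and the solution-level steps ((4.20), (4.26), the contradiction argument (4.19)–(4.27),
the Levi step (4.28), (4.31)–(4.32)) are repeated verbatim with these constants.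

Results: `inviscidAttractor_of_lt_three` (Thm. 4.4 for `0 < c < 3`, rate `β√(2^{c/3}f₀)`) and
`CheskidovFriedlander2009_thm41_of_lt_three` (Thm. 4.1 for `0 < c < 3` ⊇ `(3/2, 5/2]`); solutions
from every non-negative `ℓ²` datum exist by `exists_isSolution_inviscid` (`WeakExistence.lean`).
No new definitions of notions (bookkeeping constants `CFPc.s/q/K/θ/S`), no new facts.

## References
* [CheskidovFriedlanderPavlovic2010] DCDS 26 (2010), §1 Notation p. 3; §4 Lemma 4.1, Thms. 4.2,
  4.4, (4.1)–(4.34) pp. 6–10.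
* [CheskidovFriedlander2009] Physica D 238 (2009), Thm. 4.1 p. 9.
-/

noncomputable section

open Set Filter MeasureTheory Finset
open scoped Topology

namespace Literature.Analysis.FluidPDE.CheskidovFriedlander2009

/-! ### The constants for a general exponent `c` (`λ = 2^c`) -/

namespace CFPc

/-- `s := λ^{1/3} = 2^{c/3}`. [cite: CheskidovFriedlanderPavlovic2010, §1 (Notation) p.3 and §4 (4.2) p.6] -/
def s (c : ℝ) : ℝ := (2 : ℝ) ^ (c / 3)

/-- `q := λ^{−1/3} = 2^{−c/3}`, the ratio of the inviscid fixed point.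
[cite: CheskidovFriedlanderPavlovic2010, §4 (4.1) p.6] [cite: CheskidovFriedlander2009, §2 p.4] -/
def q (c : ℝ) : ℝ := (2 : ℝ) ^ (-(c / 3))

/-- `K := 2^{c/6}√f₀`, the amplitude of the inviscid fixed point `α_j = Kq^j`
(`inviscidFixedPoint`). [cite: CheskidovFriedlander2009, §2 p.4] -/
def K (c f₀ : ℝ) : ℝ := (2 : ℝ) ^ (c / 6) * Real.sqrt f₀

/-- `θ := (2 − s)/2` (positive iff `λ < 2³`). [cite: CheskidovFriedlanderPavlovic2010, Thm 4.2 p.8 and §1 (Notation) p.3] -/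
def θ (c : ℝ) : ℝ := (2 - s c) / 2

/-- `S := Σ_j(j+1)q^{2j}`. [cite: CheskidovFriedlanderPavlovic2010, Thm 4.4 (4.31), (4.33) p.10] -/
def S (c : ℝ) : ℝ := ∑' j : ℕ, ((j : ℝ) + 1) * (q c ^ 2) ^ j

/-- `s > 0`. [cite: CheskidovFriedlanderPavlovic2010, §4 p.6] -/
theorem s_pos (c : ℝ) : 0 < s c := Real.rpow_pos_of_pos two_pos _

/-- `s > 1` for `c > 0` (`λ > 1`). [cite: CheskidovFriedlanderPavlovic2010, §4 p.6] -/
theorem one_lt_s {c : ℝ} (hc : 0 < c) : 1 < s c := Real.one_lt_rpow (by norm_num) (by positivity)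

/-- `s < 2` for `c < 3` — "the proofs of results in section 4 require `λ < 2³`".
[cite: CheskidovFriedlanderPavlovic2010, §1 (Notation) p.3] -/
theorem s_lt_two {c : ℝ} (hc3 : c < 3) : s c < 2 := by
  have h : (2 : ℝ) ^ (c / 3) < (2 : ℝ) ^ (1 : ℝ) :=
    Real.rpow_lt_rpow_of_exponent_lt (by norm_num) (by linarith)
  rwa [Real.rpow_one] at h

/-- `q > 0`. [cite: CheskidovFriedlanderPavlovic2010, §4 (4.1) p.6] -/
theorem q_pos (c : ℝ) : 0 < q c := Real.rpow_pos_of_pos two_pos _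

/-- `q < 1` for `c > 0`. [cite: CheskidovFriedlanderPavlovic2010, §4 (4.1) p.6] -/
theorem q_lt_one {c : ℝ} (hc : 0 < c) : q c < 1 :=
  Real.rpow_lt_one_of_one_lt_of_neg (by norm_num) (by linarith)

/-- `sq = 1`. [cite: CheskidovFriedlanderPavlovic2010, §4 (4.1)–(4.2) p.6] -/
theorem s_mul_q (c : ℝ) : s c * q c = 1 := by
  rw [s, q, ← Real.rpow_add two_pos, add_neg_cancel, Real.rpow_zero]

/-- `λ = 2^c = s³`. [cite: CheskidovFriedlanderPavlovic2010, §1 (Notation) p.3] -/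
theorem two_rpow (c : ℝ) : (2 : ℝ) ^ c = s c ^ 3 := by
  rw [s, ← Real.rpow_natCast, ← Real.rpow_mul (by norm_num : (0 : ℝ) ≤ 2)]
  congr 1
  push_cast
  ring

/-- `K > 0` for `f₀ > 0`. [cite: CheskidovFriedlander2009, §2 p.4] -/
theorem K_pos (c : ℝ) {f₀ : ℝ} (hf : 0 < f₀) : 0 < K c f₀ :=
  mul_pos (Real.rpow_pos_of_pos two_pos _) (Real.sqrt_pos.mpr hf)

/-- `K ≥ 0`. [cite: CheskidovFriedlander2009, §2 p.4] -/
theorem K_nonneg (c f₀ : ℝ) : 0 ≤ K c f₀ :=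
  mul_nonneg (Real.rpow_pos_of_pos two_pos _).le (Real.sqrt_nonneg _)

/-- `K = √(2^{c/3}f₀)`. [cite: CheskidovFriedlander2009, §2 p.4] -/
theorem K_eq_sqrt (c f₀ : ℝ) : K c f₀ = Real.sqrt ((2 : ℝ) ^ (c / 3) * f₀) := by
  rw [K, Real.sqrt_mul (Real.rpow_pos_of_pos two_pos _).le, Real.sqrt_eq_rpow ((2 : ℝ) ^ (c / 3)),
    ← Real.rpow_mul (by norm_num : (0 : ℝ) ≤ 2), show c / 3 * (1 / 2) = c / 6 by ring]

/-- The tree's inviscid fixed point is `α_j = Kq^j` (definitionally). [cite: CheskidovFriedlander2009, §2 p.4] -/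
theorem inviscidFixedPoint_eq (c f₀ : ℝ) (j : ℕ) : inviscidFixedPoint c f₀ j = K c f₀ * q c ^ j := rfl

/-- The inviscid fixed point is an `ℓ²` fixed point (`c > 0`, `ν = 0`). [cite: CheskidovFriedlander2009, §2 (2.1) p.4] -/
theorem isFixedPoint {c f₀ : ℝ} (hc : 0 < c) (hf : 0 ≤ f₀) :
    IsFixedPoint c 0 (force f₀) (inviscidFixedPoint c f₀) :=
  isFixedPoint_inviscidFixedPoint hc hf

/-- `0 < θ` for `c < 3`. [cite: CheskidovFriedlanderPavlovic2010, Thm 4.2 p.8 and §1 (Notation) p.3] -/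
theorem θ_pos {c : ℝ} (hc3 : c < 3) : 0 < θ c := by
  have := s_lt_two hc3
  unfold θ
  linarith

/-- `(2 − θ)/s > 1` (`0 < c < 3`). [cite: CheskidovFriedlanderPavlovic2010, Thm 4.2 (4.24)–(4.26) p.9] -/
theorem one_lt_ratio {c : ℝ} (hc : 0 < c) (hc3 : c < 3) : 1 < (2 - θ c) / s c := by
  have h1 := one_lt_s hc
  have h2 := s_lt_two hc3
  rw [lt_div_iff₀ (s_pos c), θ]
  linarith

/-- The series `Σ_j(j+1)q^{2j}` converges (`c > 0`). [cite: CheskidovFriedlanderPavlovic2010, Thm 4.4 (4.31) p.10] -/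
theorem summable_S {c : ℝ} (hc : 0 < c) : Summable fun j : ℕ => ((j : ℝ) + 1) * (q c ^ 2) ^ j := by
  have hq2 : ‖q c ^ 2‖ < 1 := by
    rw [norm_pow, Real.norm_eq_abs, abs_of_pos (q_pos c)]
    exact pow_lt_one₀ (q_pos c).le (q_lt_one hc) two_ne_zero
  have h1 := summable_pow_mul_geometric_of_norm_lt_one 1 hq2
  have h0 := summable_geometric_of_norm_lt_one hq2
  simpa [pow_one, add_mul] using h1.add h0

/-- `S > 0`. [cite: CheskidovFriedlanderPavlovic2010, Thm 4.4 (4.33) p.10] -/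
theorem S_pos {c : ℝ} (hc : 0 < c) : 0 < S c := by
  have h := (summable_S hc).sum_le_tsum (Finset.range 1) fun j _ => by
    have := q_pos c; positivity
  simp at h
  unfold S
  linarith

/-- Partial sums are at most `S`. [cite: CheskidovFriedlanderPavlovic2010, Thm 4.4 (4.31) p.10] -/
theorem sum_le_S {c : ℝ} (hc : 0 < c) (m : ℕ) :
    ∑ j ∈ Finset.range (m + 1), ((j : ℝ) + 1) * (q c ^ 2) ^ j ≤ S c :=
  (summable_S hc).sum_le_tsum _ fun j _ => by have := q_pos c; positivity

end CFPc

/-! ### The solution-level estimates for `0 < c < 3` (verbatim repetitions of `InviscidAttractor.lean`) -/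

namespace AllExponents

/-- `|x| ≤ (1 + x²)/2` (AM–GM). [folklore] -/
private theorem abs_le_one_add_sq_half' (x : ℝ) : |x| ≤ (1 + x ^ 2) / 2 := by
  have h : 0 ≤ (|x| - 1) ^ 2 := sq_nonneg _
  have h2 : |x| ^ 2 = x ^ 2 := sq_abs x
  nlinarith

variable {c f₀ : ℝ} {a : ℕ → ℝ → ℝ}

/-- **A priori bound on the perturbation** (from the energy inequality, Thm. 3.3, at `ν = 0`):
along a solution with non-negative datum, `|a(τ) − α|²` is bounded on every `[0,T]`
(by `2(|a(0)|² + 2f₀∫₀ᵀa₀) + 2|α|²`). [cite: CheskidovFriedlanderPavlovic2010, Thm 3.3 (3.8) p.5] -/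
theorem exists_normSq_pert_le (hc : 0 < c) (hf : 0 < f₀) (ha : IsSolution c 0 (force f₀) a)
    (h0 : ∀ j, 0 ≤ a j 0) {T : ℝ} (hT : 0 ≤ T) :
    ∃ B : ℝ, 0 ≤ B ∧ ∀ τ, 0 ≤ τ → τ ≤ T →
      normSq (fun j => a j τ - inviscidFixedPoint c f₀ j) ≤ B := by
  set α : ℕ → ℝ := inviscidFixedPoint c f₀ with hαdef
  have hαsum : Summable fun j => α j ^ 2 := (CFPc.isFixedPoint hc hf.le).1
  have hc0 : c ≠ 0 := hc.ne'
  set I : ℝ := ∫ τ in (0 : ℝ)..T, a 0 τ with hI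
  have ha0i : IntervalIntegrable (a 0) volume 0 T :=
    ((ha.continuousOn 0).mono fun τ hτ => hτ.1).intervalIntegrable_of_Icc hT
  have hE0 : 0 ≤ normSq (fun j => a j 0) := tsum_nonneg fun j => sq_nonneg _
  have hEα : 0 ≤ normSq α := tsum_nonneg fun j => sq_nonneg _
  have hI0 : 0 ≤ I :=
    intervalIntegral.integral_nonneg hT fun τ hτ => ha.nonneg hc0 hf.le h0 0 τ hτ.1
  refine ⟨2 * (normSq (fun j => a j 0) + 2 * f₀ * I) + 2 * normSq α, by positivity, ?_⟩
  intro τ hτ0 hτT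
  have h1 : normSq (fun j => a j τ) ≤ normSq (fun j => a j 0) + 2 * f₀ * ∫ σ in (0 : ℝ)..τ, a 0 σ :=
    ha.normSq_le hc0 le_rfl hf.le h0 le_rfl hτ0
  have h2 : (∫ σ in (0 : ℝ)..τ, a 0 σ) ≤ I := by
    refine intervalIntegral.integral_mono_interval le_rfl hτ0 hτT ?_ ha0i
    rw [Filter.EventuallyLE, ae_restrict_iff' measurableSet_Ioc]
    exact ae_of_all _ fun σ hσ => ha.nonneg hc0 hf.le h0 0 σ hσ.1.le
  have h3 := normSq_sub_le (ha.summable_sq τ hτ0) hαsum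
  nlinarith

/-- **(4.4) integrated, = (4.20)** (scaling-covariant): for a solution of the inviscid model
(`c = 5/2`, force `f₀ > 0`) with non-negative datum, `b = a − α⁰`, `0 ≤ t₁ ≤ t₂` and every `k`,
`Σ_{j≤k}b_j(t₂)² − Σ_{j≤k}b_j(t₁)² ≤ Kq(T_{k+1} − 2T_k)`, `T_k = ∫_{t₁}^{t₂}Σ_{j≤k}D_j²`
(`= −∫Σ_{j≤k}d_j² + ∫d²_{k+1}` at `K = 1`). [cite: CheskidovFriedlanderPavlovic2010, Thm 4.2 (4.20) p.8] -/
theorem inviscid_truncPert_le (hc : 0 < c) (hf : 0 < f₀) (ha : IsSolution c 0 (force f₀) a)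
    (h0 : ∀ j, 0 ≤ a j 0) (k : ℕ) {t₁ t₂ : ℝ} (ht₁ : 0 ≤ t₁) (h12 : t₁ ≤ t₂) :
    ∑ j ∈ range (k + 1), (a j t₂ - inviscidFixedPoint c f₀ j) ^ 2
        - ∑ j ∈ range (k + 1), (a j t₁ - inviscidFixedPoint c f₀ j) ^ 2 ≤
      (CFPc.K c f₀) * (CFPc.q c) *
        ((∫ τ in t₁..t₂, ∑ j ∈ range (k + 1 + 1),
            dSeq (CFPc.s c) (fun i => a i τ - inviscidFixedPoint c f₀ i) j ^ 2)
          - 2 * ∫ τ in t₁..t₂, ∑ j ∈ range (k + 1),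
            dSeq (CFPc.s c) (fun i => a i τ - inviscidFixedPoint c f₀ i) j ^ 2) := by
  set α : ℕ → ℝ := inviscidFixedPoint c f₀ with hαdef
  have hαfix : IsFixedPoint c 0 (force f₀) α := CFPc.isFixedPoint hc hf.le
  have hαK : ∀ i, α i = (CFPc.K c f₀) * (CFPc.q c) ^ i := CFPc.inviscidFixedPoint_eq c f₀
  have hc0 : c ≠ 0 := hc.ne'
  have hcont := ha.continuousOn
  have hst' : Icc t₁ t₂ ⊆ Ici 0 := fun τ hτ => ht₁.trans hτ.1
  have hK := CFPc.K_nonneg c f₀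
  have hq := (CFPc.q_pos c).le
  -- the players
  obtain ⟨G, hG⟩ : ∃ G : ℝ → ℝ, G = fun τ => 2 * ∑ j ∈ range (k + 1),
      (a j τ - α j) * (rhs c 0 (force f₀) (fun i => a i τ) j - rhs c 0 (force f₀) α j) :=
    ⟨_, rfl⟩
  obtain ⟨P, hP⟩ : ∃ P : ℕ → ℝ → ℝ, P = fun n τ => ∑ j ∈ range (n + 1),
      dSeq (CFPc.s c) (fun i => a i τ - α i) j ^ 2 := ⟨_, rfl⟩
  have hGc : ContinuousOn G (Ici 0) := by
    rw [hG]
    exact continuousOn_const.mul (continuousOn_finsetSum _ fun j _ =>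
      ((hcont j).sub continuousOn_const).mul ((ha.continuousOn_rhs j).sub continuousOn_const))
  have hPc : ∀ n, ContinuousOn (P n) (Ici 0) := fun n => by
    rw [hP]
    exact continuousOn_finsetSum _ fun j _ => (ha.continuousOn_dSeq (CFPc.s c) α j).pow 2
  have hGi : IntervalIntegrable G volume t₁ t₂ := (hGc.mono hst').intervalIntegrable_of_Icc h12
  have hPi : ∀ n, IntervalIntegrable (P n) volume t₁ t₂ := fun n =>
    ((hPc n).mono hst').intervalIntegrable_of_Icc h12
  -- pointwise: Lemma 4.1 (4.5)
  have hpt : ∀ τ ∈ Icc t₁ t₂, G τ ≤ (CFPc.K c f₀) * (CFPc.q c) * (P (k + 1) τ - 2 * P k τ) := by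
    intro τ hτ
    have hτ0 : 0 ≤ τ := ht₁.trans hτ.1
    have hb : -α (k + 1) ≤ a (k + 1) τ - α (k + 1) := by
      have := ha.nonneg hc0 hf.le h0 (k + 1) τ hτ0
      linarith
    have h := inviscid_pert_le (CFPc.two_rpow c) (CFPc.s_mul_q c) (CFPc.s_pos c) hK hq (force f₀) α
      (fun i => a i τ - α i) hαK k hb
    have hfun : (fun i => α i + (a i τ - α i)) = fun i => a i τ := by
      funext i; ring
    rw [hfun] at h
    have hPk : P k τ = ∑ j ∈ range (k + 1), dSeq (CFPc.s c) (fun i => a i τ - α i) j ^ 2 := by rw [hP]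
    have hPk1 : P (k + 1) τ = ∑ j ∈ range (k + 1), dSeq (CFPc.s c) (fun i => a i τ - α i) j ^ 2
        + dSeq (CFPc.s c) (fun i => a i τ - α i) (k + 1) ^ 2 := by
      rw [hP]
      simp only [Finset.sum_range_succ _ (k + 1)]
    have hGτ : G τ = 2 * ∑ j ∈ range (k + 1),
        (a j τ - α j) * (rhs c 0 (force f₀) (fun i => a i τ) j - rhs c 0 (force f₀) α j) := by
      rw [hG]
    rw [hGτ, hPk, hPk1]
    linarith
  have hI : (∫ τ in t₁..t₂, G τ) ≤ ∫ τ in t₁..t₂, (CFPc.K c f₀) * (CFPc.q c) * (P (k + 1) τ - 2 * P k τ) :=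
    intervalIntegral.integral_mono_on h12 hGi
      (((hPi (k + 1)).sub ((hPi k).const_mul 2)).const_mul _) hpt
  have hR : (∫ τ in t₁..t₂, (CFPc.K c f₀) * (CFPc.q c) * (P (k + 1) τ - 2 * P k τ)) =
      (CFPc.K c f₀) * (CFPc.q c) * ((∫ τ in t₁..t₂, P (k + 1) τ) - 2 * ∫ τ in t₁..t₂, P k τ) := by
    rw [intervalIntegral.integral_const_mul, intervalIntegral.integral_sub (hPi (k + 1))
      ((hPi k).const_mul 2), intervalIntegral.integral_const_mul]
  rw [hR] at hI
  rw [ha.truncPert_eq hαfix k ht₁ h12]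
  subst hG hP
  simpa only using hI

/-- **(4.5) integrated** (the first inequality of (4.26), scaling-covariant, with the paper's
`λ^{(N+j)/3}M`, `M = (t₂−t₁)sup|b|`, replaced by an explicit bound from `|b(τ)|² ≤ B` on `[0,t₂]`):
with the data of `inviscid_truncPert_le`, for every `k`,
`(Σ_{j≤k}b_j² + Σ_{j≤k+1}b_j²)(t₂) − (same)(t₁) ≤ −2Kq∫_{t₁}^{t₂}Σ_{j≤k}D_j² + 2K²(1+B)(t₂−t₁)s^{k+1}`.
[cite: CheskidovFriedlanderPavlovic2010, Thm 4.2 (4.26) p.9 and Lemma 4.1 (4.5) p.6] -/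
theorem inviscid_truncPert_two_le (hc : 0 < c) (hf : 0 < f₀)
    (ha : IsSolution c 0 (force f₀) a) (h0 : ∀ j, 0 ≤ a j 0) (k : ℕ) {t₁ t₂ : ℝ} (ht₁ : 0 ≤ t₁)
    (h12 : t₁ ≤ t₂) {B : ℝ}
    (hB : ∀ τ, 0 ≤ τ → τ ≤ t₂ → normSq (fun j => a j τ - inviscidFixedPoint c f₀ j) ≤ B) :
    (∑ j ∈ range (k + 1), (a j t₂ - inviscidFixedPoint c f₀ j) ^ 2
        + ∑ j ∈ range (k + 1 + 1), (a j t₂ - inviscidFixedPoint c f₀ j) ^ 2)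
      - (∑ j ∈ range (k + 1), (a j t₁ - inviscidFixedPoint c f₀ j) ^ 2
        + ∑ j ∈ range (k + 1 + 1), (a j t₁ - inviscidFixedPoint c f₀ j) ^ 2) ≤
      -(2 * ((CFPc.K c f₀) * (CFPc.q c))) * (∫ τ in t₁..t₂, ∑ j ∈ range (k + 1),
            dSeq (CFPc.s c) (fun i => a i τ - inviscidFixedPoint c f₀ i) j ^ 2)
        + 2 * (CFPc.K c f₀) ^ 2 * (1 + B) * (t₂ - t₁) * (CFPc.s c) ^ (k + 1) := by
  set α : ℕ → ℝ := inviscidFixedPoint c f₀ with hαdef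
  have hαfix : IsFixedPoint c 0 (force f₀) α := CFPc.isFixedPoint hc hf.le
  have hαsum : Summable fun j => α j ^ 2 := hαfix.1
  have hαK : ∀ i, α i = (CFPc.K c f₀) * (CFPc.q c) ^ i := CFPc.inviscidFixedPoint_eq c f₀
  have hc0 : c ≠ 0 := hc.ne'
  have hcont := ha.continuousOn
  have hst' : Icc t₁ t₂ ⊆ Ici 0 := fun τ hτ => ht₁.trans hτ.1
  have hK := CFPc.K_nonneg c f₀
  have hq := (CFPc.q_pos c).le
  have hs := (CFPc.s_pos c)
  have hsq := (CFPc.s_mul_q c)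
  -- the players
  obtain ⟨G, hG⟩ : ∃ G : ℕ → ℝ → ℝ, G = fun n τ => 2 * ∑ j ∈ range (n + 1),
      (a j τ - α j) * (rhs c 0 (force f₀) (fun i => a i τ) j - rhs c 0 (force f₀) α j) :=
    ⟨_, rfl⟩
  obtain ⟨P, hP⟩ : ∃ P : ℝ → ℝ, P = fun τ => ∑ j ∈ range (k + 1),
      dSeq (CFPc.s c) (fun i => a i τ - α i) j ^ 2 := ⟨_, rfl⟩
  obtain ⟨C, hC⟩ : ∃ C : ℝ, C = 2 * (CFPc.K c f₀) ^ 2 * (1 + B) * (CFPc.s c) ^ (k + 1) := ⟨_, rfl⟩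
  have hGc : ∀ n, ContinuousOn (G n) (Ici 0) := fun n => by
    rw [hG]
    exact continuousOn_const.mul (continuousOn_finsetSum _ fun j _ =>
      ((hcont j).sub continuousOn_const).mul ((ha.continuousOn_rhs j).sub continuousOn_const))
  have hPc : ContinuousOn P (Ici 0) := by
    rw [hP]
    exact continuousOn_finsetSum _ fun j _ => (ha.continuousOn_dSeq (CFPc.s c) α j).pow 2
  have hGi : ∀ n, IntervalIntegrable (G n) volume t₁ t₂ := fun n =>
    ((hGc n).mono hst').intervalIntegrable_of_Icc h12
  have hPi : IntervalIntegrable P volume t₁ t₂ := (hPc.mono hst').intervalIntegrable_of_Icc h12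
  -- pointwise: Lemma 4.1 (4.6) with the cross term bounded
  have hpt : ∀ τ ∈ Icc t₁ t₂, G (k + 1) τ + G k τ ≤ -(2 * ((CFPc.K c f₀) * (CFPc.q c))) * P τ + C := by
    intro τ hτ
    have hτ0 : 0 ≤ τ := ht₁.trans hτ.1
    have hpos := fun j => ha.nonneg hc0 hf.le h0 j τ hτ0
    have hb1 : -α (k + 1) ≤ a (k + 1) τ - α (k + 1) := by linarith [hpos (k + 1)]
    have hb2 : -α (k + 2) ≤ a (k + 2) τ - α (k + 2) := by linarith [hpos (k + 2)]
    have h := inviscid_pert_le_two_levels (CFPc.two_rpow c) hsq hs (force f₀) α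
      (fun i => a i τ - α i) hαK k hb1 hb2
    have hfun : (fun i => α i + (a i τ - α i)) = fun i => a i τ := by
      funext i; ring
    rw [hfun] at h
    -- the cross term: `−b_{k+1}b_{k+2} ≤ α_{k+1}|b_{k+2}| + α_{k+2}|b_{k+1}| ≤ α_{k+1}(1 + B)`
    have hαnn : ∀ j, 0 ≤ α j := fun j => by rw [hαK]; positivity
    have hcross := neg_mul_le_of_neg_le (hαnn (k + 1)) (hαnn (k + 2)) hb1 hb2
    have hBτ := hB τ hτ0 hτ.2
    have hsumτ : Summable fun j => (a j τ - α j) ^ 2 :=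
      summable_sq_sub_of_sq (ha.summable_sq τ hτ0) hαsum
    have hsq1 : (a (k + 1) τ - α (k + 1)) ^ 2 ≤ B :=
      (hsumτ.le_tsum (k + 1) fun j _ => sq_nonneg _).trans hBτ
    have hsq2 : (a (k + 2) τ - α (k + 2)) ^ 2 ≤ B :=
      (hsumτ.le_tsum (k + 2) fun j _ => sq_nonneg _).trans hBτ
    have habs1 : |a (k + 1) τ - α (k + 1)| ≤ (1 + B) / 2 :=
      (abs_le_one_add_sq_half' _).trans (by linarith)
    have habs2 : |a (k + 2) τ - α (k + 2)| ≤ (1 + B) / 2 :=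
      (abs_le_one_add_sq_half' _).trans (by linarith)
    have hα21 : α (k + 2) ≤ α (k + 1) := by
      rw [hαK, hαK, pow_succ, ← mul_assoc]
      exact mul_le_of_le_one_right (by positivity) (CFPc.q_lt_one hc).le
    have hcross' : -((a (k + 1) τ - α (k + 1)) * (a (k + 2) τ - α (k + 2))) ≤
        α (k + 1) * (1 + B) := by
      have e1 := mul_le_mul_of_nonneg_left habs2 (hαnn (k + 1))
      have e2 : α (k + 2) * |a (k + 1) τ - α (k + 1)| ≤ α (k + 1) * ((1 + B) / 2) :=
        (mul_le_mul_of_nonneg_right hα21 (abs_nonneg _)).trans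
          (mul_le_mul_of_nonneg_left habs1 (hαnn (k + 1)))
      linarith
    -- `K s^{2(k+1)} α_{k+1} (1 + B) = K²(1 + B) s^{k+1}`
    have hcoef : (CFPc.K c f₀) * (CFPc.s c) ^ (2 * (k + 1)) * (α (k + 1) * (1 + B)) =
        (CFPc.K c f₀) ^ 2 * (1 + B) * (CFPc.s c) ^ (k + 1) := by
      rw [hαK]
      calc (CFPc.K c f₀) * (CFPc.s c) ^ (2 * (k + 1)) * ((CFPc.K c f₀) * (CFPc.q c) ^ (k + 1) * (1 + B))
          = (CFPc.K c f₀) ^ 2 * (1 + B) * (CFPc.s c) ^ (k + 1) * ((CFPc.s c) * (CFPc.q c)) ^ (k + 1) := by ring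
        _ = (CFPc.K c f₀) ^ 2 * (1 + B) * (CFPc.s c) ^ (k + 1) := by rw [hsq, one_pow, mul_one]
    have hKs : 0 ≤ (CFPc.K c f₀) * (CFPc.s c) ^ (2 * (k + 1)) := by positivity
    have hmain := mul_le_mul_of_nonneg_left hcross' hKs
    have hG1 : G (k + 1) τ = 2 * ∑ j ∈ range (k + 2),
        (a j τ - α j) * (rhs c 0 (force f₀) (fun i => a i τ) j - rhs c 0 (force f₀) α j) := by
      rw [hG]
    have hG0 : G k τ = 2 * ∑ j ∈ range (k + 1),
        (a j τ - α j) * (rhs c 0 (force f₀) (fun i => a i τ) j - rhs c 0 (force f₀) α j) := by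
      rw [hG]
    have hPτ : P τ = ∑ j ∈ range (k + 1), dSeq (CFPc.s c) (fun i => a i τ - α i) j ^ 2 := by rw [hP]
    rw [hG1, hG0, hPτ, hC]
    linarith
  -- integrate
  have hI : (∫ τ in t₁..t₂, G (k + 1) τ + G k τ) ≤
      ∫ τ in t₁..t₂, (-(2 * ((CFPc.K c f₀) * (CFPc.q c))) * P τ + C) :=
    intervalIntegral.integral_mono_on h12 ((hGi (k + 1)).add (hGi k))
      ((hPi.const_mul _).add intervalIntegrable_const) hpt
  rw [intervalIntegral.integral_add (hGi (k + 1)) (hGi k),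
    intervalIntegral.integral_add (hPi.const_mul _) intervalIntegrable_const,
    intervalIntegral.integral_const_mul, intervalIntegral.integral_const, smul_eq_mul] at hI
  have e1 : ∑ j ∈ range (k + 1), (a j t₂ - α j) ^ 2 - ∑ j ∈ range (k + 1), (a j t₁ - α j) ^ 2 =
      ∫ τ in t₁..t₂, G k τ := by
    rw [ha.truncPert_eq hαfix k ht₁ h12, hG]
  have e2 : ∑ j ∈ range (k + 1 + 1), (a j t₂ - α j) ^ 2 - ∑ j ∈ range (k + 1 + 1), (a j t₁ - α j) ^ 2 =
      ∫ τ in t₁..t₂, G (k + 1) τ := by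
    rw [ha.truncPert_eq hαfix (k + 1) ht₁ h12, hG]
  have e3 : (∫ τ in t₁..t₂, ∑ j ∈ range (k + 1), dSeq (CFPc.s c) (fun i => a i τ - α i) j ^ 2) =
      ∫ τ in t₁..t₂, P τ := by rw [hP]
  have e4 : (t₂ - t₁) * C = 2 * (CFPc.K c f₀) ^ 2 * (1 + B) * (t₂ - t₁) * (CFPc.s c) ^ (k + 1) := by
    rw [hC]; ring
  rw [e3]
  linarith

/-! ### Thm. 4.2: the contradiction argument and the limit `k → ∞` -/

/-- **Thm. 4.2, the heart of the proof** ((4.19)–(4.27): "we have shown that for any `N > 0` there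
exists `k > N`, such that (4.27)"), scaling-covariant: for a solution of the inviscid model with
non-negative datum, `0 ≤ t₁ ≤ t₂` and every `N` there is `k ≥ N` with
`Σ_{j≤k}b_j(t₂)² − Σ_{j≤k}b_j(t₁)² ≤ −θKq∫_{t₁}^{t₂}Σ_{j≤k}D_j²`.
Proof as printed: otherwise ((4.19)) `T_{k+1} > (2−θ)T_k` for `k ≥ N` (from (4.20), cf.
(4.21)–(4.23)), so `T_k` grows at least like `(2−θ)^k` ((4.24)–(4.25)), while (4.5) integrated
bounds `T_k ≤ A + Cs^{k+1}` ((4.26)); as `2 − θ > s` this is absurd ("the right hand side goes to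
`−∞` as `j → ∞`"). [cite: CheskidovFriedlanderPavlovic2010, Thm 4.2 (4.19)–(4.27) p.8–9] -/
theorem exists_trunc_le (hc : 0 < c) (hc3 : c < 3) (hf : 0 < f₀) (ha : IsSolution c 0 (force f₀) a)
    (h0 : ∀ j, 0 ≤ a j 0) {t₁ t₂ : ℝ} (ht₁ : 0 ≤ t₁) (h12 : t₁ ≤ t₂) (N : ℕ) :
    ∃ k, N ≤ k ∧
      ∑ j ∈ range (k + 1), (a j t₂ - inviscidFixedPoint c f₀ j) ^ 2
          - ∑ j ∈ range (k + 1), (a j t₁ - inviscidFixedPoint c f₀ j) ^ 2 ≤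
        -((CFPc.θ c) * ((CFPc.K c f₀) * (CFPc.q c))) * ∫ τ in t₁..t₂, ∑ j ∈ range (k + 1),
          dSeq (CFPc.s c) (fun i => a i τ - inviscidFixedPoint c f₀ i) j ^ 2 := by
  set α : ℕ → ℝ := inviscidFixedPoint c f₀ with hαdef
  have hαsum : Summable fun j => α j ^ 2 := (CFPc.isFixedPoint hc hf.le).1
  have hst' : Icc t₁ t₂ ⊆ Ici 0 := fun τ hτ => ht₁.trans hτ.1
  have hKq : 0 < (CFPc.K c f₀) * (CFPc.q c) := mul_pos (CFPc.K_pos c hf) (CFPc.q_pos c)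
  have hθ := (CFPc.θ_pos hc3)
  have hs1 := (CFPc.one_lt_s hc)
  have hs2 := (CFPc.s_lt_two hc3)
  have hs0 := (CFPc.s_pos c)
  -- the quantities `E_k(t)` and `T_k`
  set E : ℕ → ℝ → ℝ := fun k t => ∑ j ∈ range (k + 1), (a j t - α j) ^ 2 with hE
  set T : ℕ → ℝ := fun k => ∫ τ in t₁..t₂, ∑ j ∈ range (k + 1),
    dSeq (CFPc.s c) (fun i => a i τ - α i) j ^ 2 with hT
  have hPc : ∀ n, ContinuousOn (fun τ => ∑ j ∈ range (n + 1),
      dSeq (CFPc.s c) (fun i => a i τ - α i) j ^ 2) (Icc t₁ t₂) := fun n =>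
    (continuousOn_finsetSum _ fun j _ => (ha.continuousOn_dSeq (CFPc.s c) α j).pow 2).mono hst'
  have hT0 : ∀ k, 0 ≤ T k := fun k =>
    intervalIntegral.integral_nonneg h12 fun τ _ => sum_nonneg fun j _ => sq_nonneg _
  have hE0 : ∀ k t, 0 ≤ E k t := fun k t => sum_nonneg fun j _ => sq_nonneg _
  have hEle : ∀ k, E k t₁ ≤ normSq (fun j => a j t₁ - α j) := fun k =>
    (summable_sq_sub_of_sq (ha.summable_sq t₁ ht₁) hαsum).sum_le_tsum _ fun j _ => sq_nonneg _
  -- the a priori bound and the two integrated inequalities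
  obtain ⟨B, hB0, hB⟩ := exists_normSq_pert_le hc hf ha h0 (ht₁.trans h12)
  have hI : ∀ k, E k t₂ - E k t₁ ≤ (CFPc.K c f₀) * (CFPc.q c) * (T (k + 1) - 2 * T k) := fun k =>
    inviscid_truncPert_le hc hf ha h0 k ht₁ h12
  have hII : ∀ k, (E k t₂ + E (k + 1) t₂) - (E k t₁ + E (k + 1) t₁) ≤
      -(2 * ((CFPc.K c f₀) * (CFPc.q c))) * T k + 2 * (CFPc.K c f₀) ^ 2 * (1 + B) * (t₂ - t₁) * (CFPc.s c) ^ (k + 1) :=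
    fun k => inviscid_truncPert_two_le hc hf ha h0 k ht₁ h12 hB
  have hK0 := CFPc.K_pos c hf
  have hq0 := (CFPc.q_pos c)
  have h2θ : 0 ≤ 2 - (CFPc.θ c) := by unfold CFPc.θ; linarith
  by_contra H
  push Not at H
  -- (4.21) ⇒ (4.22): `T_{k+1} > (2 − θ)T_k` for `k ≥ N`
  have hgrow : ∀ k, N ≤ k → (2 - (CFPc.θ c)) * T k < T (k + 1) := by
    intro k hk
    have h1 := H k hk
    have h2 := hI k
    by_contra h3
    push Not at h3
    have := mul_le_mul_of_nonneg_left h3 hKq.le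
    nlinarith
  have hTpos : 0 < T (N + 1) := by
    have := hgrow N le_rfl
    nlinarith [mul_nonneg h2θ (hT0 N)]
  -- (4.24): geometric growth
  have hlow : ∀ i : ℕ, (2 - (CFPc.θ c)) ^ i * T (N + 1) ≤ T (N + 1 + i) := by
    intro i
    induction i with
    | zero => simp
    | succ i ih =>
      have hg := hgrow (N + 1 + i) (by omega)
      rw [show N + 1 + (i + 1) = N + 1 + i + 1 by omega]
      calc (2 - (CFPc.θ c)) ^ (i + 1) * T (N + 1) = (2 - (CFPc.θ c)) * ((2 - (CFPc.θ c)) ^ i * T (N + 1)) := by ring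
        _ ≤ (2 - (CFPc.θ c)) * T (N + 1 + i) := mul_le_mul_of_nonneg_left ih h2θ
        _ ≤ T (N + 1 + i + 1) := hg.le
  -- (4.25): the upper bound `2Kq T_k ≤ 2|b(t₁)|² + C s^{k+1}`
  set Cst : ℝ := 2 * (CFPc.K c f₀) ^ 2 * (1 + B) * (t₂ - t₁) with hCst
  have hCst0 : 0 ≤ Cst := by
    have : 0 ≤ t₂ - t₁ := by linarith
    positivity
  have hup : ∀ k, 2 * ((CFPc.K c f₀) * (CFPc.q c)) * T k ≤
      2 * normSq (fun j => a j t₁ - α j) + Cst * (CFPc.s c) ^ (k + 1) := by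
    intro k
    have h := hII k
    have := hE0 k t₂
    have := hE0 (k + 1) t₂
    have := hEle k
    have := hEle (k + 1)
    nlinarith
  -- combine: `((2−θ)/s)^i ≤ M₀` for all `i`, contradicting `(2−θ)/s > 1`
  set nb : ℝ := normSq (fun j => a j t₁ - α j) with hnb
  have hnb0 : 0 ≤ nb := tsum_nonneg fun j => sq_nonneg _
  set M₀ : ℝ := (2 * nb + Cst * (CFPc.s c) ^ (N + 2)) / (2 * ((CFPc.K c f₀) * (CFPc.q c)) * T (N + 1)) with hM₀
  have hden : 0 < 2 * ((CFPc.K c f₀) * (CFPc.q c)) * T (N + 1) := by positivity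
  have hbound : ∀ i : ℕ, ((2 - (CFPc.θ c)) / (CFPc.s c)) ^ i ≤ M₀ := by
    intro i
    have h1 := hlow i
    have h2 := hup (N + 1 + i)
    have hsi : 1 ≤ (CFPc.s c) ^ i := one_le_pow₀ hs1.le
    have hsi0 : 0 < (CFPc.s c) ^ i := pow_pos hs0 i
    have e : Cst * (CFPc.s c) ^ (N + 1 + i + 1) = Cst * (CFPc.s c) ^ (N + 2) * (CFPc.s c) ^ i := by
      rw [show N + 1 + i + 1 = N + 2 + i by omega, pow_add]; ring
    rw [e] at h2
    have h3 : 2 * nb ≤ 2 * nb * (CFPc.s c) ^ i := by nlinarith [mul_nonneg hnb0 (sub_nonneg.2 hsi)]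
    have key : (2 - (CFPc.θ c)) ^ i * (2 * ((CFPc.K c f₀) * (CFPc.q c)) * T (N + 1)) ≤
        (2 * nb + Cst * (CFPc.s c) ^ (N + 2)) * (CFPc.s c) ^ i :=
      calc (2 - (CFPc.θ c)) ^ i * (2 * ((CFPc.K c f₀) * (CFPc.q c)) * T (N + 1))
          = 2 * ((CFPc.K c f₀) * (CFPc.q c)) * ((2 - (CFPc.θ c)) ^ i * T (N + 1)) := by ring
        _ ≤ 2 * ((CFPc.K c f₀) * (CFPc.q c)) * T (N + 1 + i) := mul_le_mul_of_nonneg_left h1 (by positivity)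
        _ ≤ 2 * nb + Cst * (CFPc.s c) ^ (N + 2) * (CFPc.s c) ^ i := h2
        _ ≤ (2 * nb + Cst * (CFPc.s c) ^ (N + 2)) * (CFPc.s c) ^ i := by rw [add_mul]; linarith
    rw [div_pow, div_le_iff₀ hsi0]
    calc (2 - (CFPc.θ c)) ^ i
        = (2 - (CFPc.θ c)) ^ i * (2 * ((CFPc.K c f₀) * (CFPc.q c)) * T (N + 1)) / (2 * ((CFPc.K c f₀) * (CFPc.q c)) * T (N + 1)) := by
          field_simp
      _ ≤ (2 * nb + Cst * (CFPc.s c) ^ (N + 2)) * (CFPc.s c) ^ i / (2 * ((CFPc.K c f₀) * (CFPc.q c)) * T (N + 1)) :=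
          div_le_div_of_nonneg_right key hden.le
      _ = M₀ * (CFPc.s c) ^ i := by rw [hM₀]; ring
  obtain ⟨i, hi⟩ := ((tendsto_pow_atTop_atTop_of_one_lt (CFPc.one_lt_ratio hc hc3)).eventually_gt_atTop M₀).exists
  exact absurd (hbound i) (not_le.mpr hi)

/-- **Thm. 4.2, (4.27) → (4.28), truncated on the right** ("taking a limit as `N → ∞` and using
Levi's convergence theorem"), scaling-covariant: for a solution of the inviscid model with
non-negative datum, `b = a − α⁰`, `0 ≤ t₁ ≤ t₂` and every `m`,
`|b(t₂)|² − |b(t₁)|² ≤ −θKq∫_{t₁}^{t₂}Σ_{j≤m}D_j²` ((4.18)/(4.28) with `∫|d|²` truncated; the full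
`∫|d|²` is the supremum over `m`). [cite: CheskidovFriedlanderPavlovic2010, Thm 4.2 (4.18) p.8 and (4.27)–(4.28) p.9–10] -/
theorem normSq_pert_le_dSeq (hc : 0 < c) (hc3 : c < 3) (hf : 0 < f₀) (ha : IsSolution c 0 (force f₀) a)
    (h0 : ∀ j, 0 ≤ a j 0) (m : ℕ) {t₁ t₂ : ℝ} (ht₁ : 0 ≤ t₁) (h12 : t₁ ≤ t₂) :
    normSq (fun j => a j t₂ - inviscidFixedPoint c f₀ j)
        - normSq (fun j => a j t₁ - inviscidFixedPoint c f₀ j) ≤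
      -((CFPc.θ c) * ((CFPc.K c f₀) * (CFPc.q c))) * ∫ τ in t₁..t₂, ∑ j ∈ range (m + 1),
        dSeq (CFPc.s c) (fun i => a i τ - inviscidFixedPoint c f₀ i) j ^ 2 := by
  set α : ℕ → ℝ := inviscidFixedPoint c f₀ with hαdef
  have hαsum : Summable fun j => α j ^ 2 := (CFPc.isFixedPoint hc hf.le).1
  have hst' : Icc t₁ t₂ ⊆ Ici 0 := fun τ hτ => ht₁.trans hτ.1
  have hθKq : 0 ≤ (CFPc.θ c) * ((CFPc.K c f₀) * (CFPc.q c)) :=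
    mul_nonneg (CFPc.θ_pos hc3).le (mul_nonneg (CFPc.K_nonneg c f₀) (CFPc.q_pos c).le)
  have hPc : ∀ n, ContinuousOn (fun τ => ∑ j ∈ range (n + 1),
      dSeq (CFPc.s c) (fun i => a i τ - α i) j ^ 2) (Icc t₁ t₂) := fun n =>
    (continuousOn_finsetSum _ fun j _ => (ha.continuousOn_dSeq (CFPc.s c) α j).pow 2).mono hst'
  refine le_of_forall_pos_le_add fun ε hε => ?_
  have hl₁ := Metric.tendsto_atTop.1 (ha.tendsto_truncPert hαsum ht₁) (ε / 2) (half_pos hε)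
  have hl₂ := Metric.tendsto_atTop.1 (ha.tendsto_truncPert hαsum (ht₁.trans h12)) (ε / 2) (half_pos hε)
  obtain ⟨N₁, hN₁⟩ := hl₁
  obtain ⟨N₂, hN₂⟩ := hl₂
  obtain ⟨k, hk, hdec⟩ := exists_trunc_le hc hc3 hf ha h0 ht₁ h12 (max m (max N₁ N₂))
  have hkm : m ≤ k := le_trans (le_max_left _ _) hk
  have hk1 : N₁ ≤ k := le_trans ((le_max_left _ _).trans (le_max_right _ _)) hk
  have hk2 : N₂ ≤ k := le_trans ((le_max_right _ _).trans (le_max_right _ _)) hk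
  have hTm : (∫ τ in t₁..t₂, ∑ j ∈ range (m + 1), dSeq (CFPc.s c) (fun i => a i τ - α i) j ^ 2) ≤
      ∫ τ in t₁..t₂, ∑ j ∈ range (k + 1), dSeq (CFPc.s c) (fun i => a i τ - α i) j ^ 2 :=
    intervalIntegral.integral_mono_on h12 ((hPc m).intervalIntegrable_of_Icc h12)
      ((hPc k).intervalIntegrable_of_Icc h12) fun τ _ =>
        sum_le_sum_of_subset_of_nonneg (range_mono (by omega)) fun _ _ _ => sq_nonneg _
  have d1 := hN₁ k hk1
  have d2 := hN₂ k hk2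
  rw [Real.dist_eq, abs_lt] at d1 d2
  nlinarith [mul_le_mul_of_nonneg_left hTm hθKq, d1.1, d1.2, d2.1, d2.2]

/-- **(4.32) truncated** (Thm. 4.2 combined with (4.31)), scaling-covariant: for a solution of the
inviscid model with non-negative datum, `b = a − α⁰`, `0 ≤ t₁ ≤ t₂` and every `m`,
`|b(t₂)|² − |b(t₁)|² ≤ −(θKq/S)∫_{t₁}^{t₂}Σ_{j≤m}b_j²`.
[cite: CheskidovFriedlanderPavlovic2010, Thm 4.4 (4.31)–(4.32) p.10] -/
theorem normSq_pert_le_trunc (hc : 0 < c) (hc3 : c < 3) (hf : 0 < f₀) (ha : IsSolution c 0 (force f₀) a)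
    (h0 : ∀ j, 0 ≤ a j 0) (m : ℕ) {t₁ t₂ : ℝ} (ht₁ : 0 ≤ t₁) (h12 : t₁ ≤ t₂) :
    normSq (fun j => a j t₂ - inviscidFixedPoint c f₀ j)
        - normSq (fun j => a j t₁ - inviscidFixedPoint c f₀ j) ≤
      -((CFPc.θ c) * ((CFPc.K c f₀) * (CFPc.q c)) / (CFPc.S c)) * ∫ τ in t₁..t₂, ∑ j ∈ range (m + 1),
        (a j τ - inviscidFixedPoint c f₀ j) ^ 2 := by
  set α : ℕ → ℝ := inviscidFixedPoint c f₀ with hαdef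
  have hst' : Icc t₁ t₂ ⊆ Ici 0 := fun τ hτ => ht₁.trans hτ.1
  have hS := (CFPc.S_pos hc)
  have hθKq : 0 ≤ (CFPc.θ c) * ((CFPc.K c f₀) * (CFPc.q c)) :=
    mul_nonneg (CFPc.θ_pos hc3).le (mul_nonneg (CFPc.K_nonneg c f₀) (CFPc.q_pos c).le)
  have h := normSq_pert_le_dSeq hc hc3 hf ha h0 m ht₁ h12
  have hPc : ContinuousOn (fun τ => ∑ j ∈ range (m + 1),
      dSeq (CFPc.s c) (fun i => a i τ - α i) j ^ 2) (Icc t₁ t₂) :=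
    (continuousOn_finsetSum _ fun j _ => (ha.continuousOn_dSeq (CFPc.s c) α j).pow 2).mono hst'
  have hEc : ContinuousOn (fun τ => ∑ j ∈ range (m + 1), (a j τ - α j) ^ 2) (Icc t₁ t₂) :=
    (continuousOn_finsetSum _ fun j _ => ((ha.continuousOn j).sub continuousOn_const).pow 2).mono hst'
  -- (4.31) pointwise, then integrated: `∫Σb_j² ≤ S∫ΣD_j²`
  have hpt : ∀ τ ∈ Icc t₁ t₂, ∑ j ∈ range (m + 1), (a j τ - α j) ^ 2 ≤
      (CFPc.S c) * ∑ j ∈ range (m + 1), dSeq (CFPc.s c) (fun i => a i τ - α i) j ^ 2 := by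
    intro τ _
    have h1 := sum_sq_le_dSeq (CFPc.s_mul_q c) (fun i => a i τ - α i) m
    have h2 := CFPc.sum_le_S hc m
    have h3 : 0 ≤ ∑ j ∈ range (m + 1), dSeq (CFPc.s c) (fun i => a i τ - α i) j ^ 2 :=
      sum_nonneg fun j _ => sq_nonneg _
    exact h1.trans (mul_le_mul_of_nonneg_right h2 h3)
  have hI : (∫ τ in t₁..t₂, ∑ j ∈ range (m + 1), (a j τ - α j) ^ 2) ≤
      ∫ τ in t₁..t₂, (CFPc.S c) * ∑ j ∈ range (m + 1), dSeq (CFPc.s c) (fun i => a i τ - α i) j ^ 2 :=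
    intervalIntegral.integral_mono_on h12 (hEc.intervalIntegrable_of_Icc h12)
      ((hPc.intervalIntegrable_of_Icc h12).const_mul _) hpt
  rw [intervalIntegral.integral_const_mul] at hI
  have e : -((CFPc.θ c) * ((CFPc.K c f₀) * (CFPc.q c)) / (CFPc.S c)) * ((CFPc.S c) * ∫ τ in t₁..t₂, ∑ j ∈ range (m + 1),
      dSeq (CFPc.s c) (fun i => a i τ - α i) j ^ 2) = -((CFPc.θ c) * ((CFPc.K c f₀) * (CFPc.q c))) *
        ∫ τ in t₁..t₂, ∑ j ∈ range (m + 1), dSeq (CFPc.s c) (fun i => a i τ - α i) j ^ 2 := by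
    field_simp
  have hθS : 0 ≤ (CFPc.θ c) * ((CFPc.K c f₀) * (CFPc.q c)) / (CFPc.S c) := div_nonneg hθKq hS.le
  have := mul_le_mul_of_nonneg_left hI hθS
  linarith

/-! ### Theorem 4.4 and CF 2009 Theorem 4.1 -/

/-- **Cheskidov–Friedlander–Pavlović 2010, Theorem 4.4 for every `λ = 2^c < 2³`** ("the results
are qualitatively independent of the exact choice of `λ` … The proofs of results in section 4
require `λ < 2³`", Notation p. 3): for `0 < c < 3` there is `β > 0` (`β = θq/(2S)` with the
constants of `CFPc`) such that for every `f₀ > 0` and every solution `a` of the inviscid model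
(1.2) with exponent `c` and `a_j(0) ≥ 0`, `|a(t) − α⁰|² ≤ |a(0) − α⁰|²e^{−β√(2^{c/3}f₀)t}` for all
`t ≥ 0`, `α⁰_j = 2^{c/6}√f₀·2^{−cj/3}`.  At `c = 5/2` this is `CheskidovFriedlanderPavlovic2010_thm44`
(`…_holds`, `InviscidAttractor.lean`). [cite: CheskidovFriedlanderPavlovic2010, Thm 4.4 (4.30) p.10 and §1 (Notation) p.3] -/
theorem inviscidAttractor_of_lt_three {c : ℝ} (hc : 0 < c) (hc3 : c < 3) :
    ∃ β : ℝ, 0 < β ∧ ∀ f₀ : ℝ, 0 < f₀ →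
      ∀ a : ℕ → ℝ → ℝ, IsSolution c 0 (force f₀) a → (∀ j, 0 ≤ a j 0) →
        ∀ t : ℝ, 0 ≤ t →
          normSq (fun j => a j t - inviscidFixedPoint c f₀ j) ≤
            normSq (fun j => a j 0 - inviscidFixedPoint c f₀ j) *
              Real.exp (-(β * Real.sqrt ((2 : ℝ) ^ (c / 3) * f₀) * t)) := by
  refine ⟨(CFPc.θ c) * (CFPc.q c) / (2 * (CFPc.S c)), by
    have := CFPc.θ_pos hc3; have := CFPc.q_pos c; have := CFPc.S_pos hc; positivity, ?_⟩
  intro f₀ hf a ha h0 t ht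
  have hαsum : Summable fun j => inviscidFixedPoint c f₀ j ^ 2 := (CFPc.isFixedPoint hc hf.le).1
  have hβ : 0 < (CFPc.θ c) * ((CFPc.K c f₀) * (CFPc.q c)) / (CFPc.S c) :=
    div_pos (mul_pos (CFPc.θ_pos hc3) (mul_pos (CFPc.K_pos c hf) (CFPc.q_pos c))) (CFPc.S_pos hc)
  have h := ha.normSq_exp_decay_of_trunc hαsum hβ
    (fun m s u hs hsu => normSq_pert_le_trunc hc hc3 hf ha h0 m hs hsu) ht
  rw [← CFPc.K_eq_sqrt c f₀]
  convert h using 3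
  ring

/-- **Cheskidov–Friedlander 2009, Theorem 4.1 (the inviscid anomalous dissipation rate) in its
printed range and beyond** (p. 9: "Let `a⁰(t)` be a solution to the inviscid dyadic model on
`[0,∞)`. Then `lim_{T→∞} T⁻¹∫₀ᵀ dε_{a⁰}(t) =: ε_d > 0`", standing `c ∈ (3/2, 5/2]`, "proved in
[CFP]"): for every `0 < c < 3`, `f₀ > 0` and every solution `a` of the inviscid model with
non-negative `ℓ²` datum, the time average of the anomalous dissipation
`T⁻¹[∫₀ᵀ(a(t),f)dt − ½(|a(T)|² − |a(0)|²)]` tends to `ε_d = f₀α⁰₀`.  (At `c = 5/2`: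
`CheskidovFriedlander2009_thm41`, `InviscidAttractor.lean`.) Proof: the Cesàro mean of `f₀a₀(t)`
tends to `f₀α⁰₀` since `a₀(t) → α⁰₀` (`inviscidAttractor_of_lt_three`), and the energy increment is
bounded. [cite: CheskidovFriedlander2009, Thm 4.1 p.9] [cite: CheskidovFriedlanderPavlovic2010, Thm 4.4 p.10 and §6 p.14–15] -/
theorem CheskidovFriedlander2009_thm41_of_lt_three {c : ℝ} (hc : 0 < c) (hc3 : c < 3) {f₀ : ℝ}
    (hf : 0 < f₀) {a : ℕ → ℝ → ℝ} (ha : IsSolution c 0 (force f₀) a) (h0 : ∀ j, 0 ≤ a j 0) :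
    Tendsto (fun T : ℝ => T⁻¹ * ((∫ t in (0 : ℝ)..T, f₀ * a 0 t)
        - (normSq (fun j => a j T) - normSq (fun j => a j 0)) / 2)) atTop
      (𝓝 (epsilonD c f₀)) := by
  obtain ⟨β, hβ, hatt⟩ := inviscidAttractor_of_lt_three hc hc3
  set α : ℕ → ℝ := inviscidFixedPoint c f₀ with hαdef
  have hαsum : Summable fun j => α j ^ 2 := (CFPc.isFixedPoint hc hf.le).1
  set κ : ℝ := β * Real.sqrt ((2 : ℝ) ^ (c / 3) * f₀) with hκdef
  have hκ : 0 < κ := by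
    have : 0 < (2 : ℝ) ^ (c / 3) * f₀ := mul_pos (Real.rpow_pos_of_pos two_pos _) hf
    exact mul_pos hβ (Real.sqrt_pos.mpr this)
  set D₀ : ℝ := normSq (fun j => a j 0 - α j) with hD₀
  have hdec : ∀ t, 0 ≤ t → normSq (fun j => a j t - α j) ≤ D₀ * Real.exp (-(κ * t)) := by
    intro t ht
    have := hatt f₀ hf a ha h0 t ht
    simpa [hαdef, hκdef, hD₀, mul_assoc] using this
  -- (1) the mean of `f₀ a₀` tends to `f₀ α₀ = ε_d`
  have hmode := tendsto_mode_zero_of_exp_decay ha hαsum hκ hdec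
  have hces : Tendsto (fun T : ℝ => T⁻¹ * ∫ t in (0 : ℝ)..T, f₀ * a 0 t) atTop
      (𝓝 (epsilonD c f₀)) := by
    have hcont : ContinuousOn (fun t => f₀ * a 0 t) (Ici 0) :=
      continuousOn_const.mul (ha.continuousOn 0)
    have := tendsto_cesaro hcont (hmode.const_mul f₀)
    simpa [epsilonD, hαdef] using this
  -- (2) the energy increment is bounded, so its mean tends to `0`
  have hD₀nn : 0 ≤ D₀ := tsum_nonneg fun j => sq_nonneg _
  have hbound : ∀ T, 0 ≤ T → |normSq (fun j => a j T) - normSq (fun j => a j 0)| ≤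
      2 * D₀ + 2 * normSq α + normSq (fun j => a j 0) := by
    intro T hT
    have hET : 0 ≤ normSq (fun j => a j T) := tsum_nonneg fun j => sq_nonneg _
    have hE0 : 0 ≤ normSq (fun j => a j 0) := tsum_nonneg fun j => sq_nonneg _
    have h1 := normSq_le_two_mul_pert (ha.summable_sq T hT) hαsum
    have h2 : normSq (fun j => a j T - α j) ≤ D₀ := by
      refine (hdec T hT).trans ?_
      have : Real.exp (-(κ * T)) ≤ 1 := Real.exp_le_one_iff.mpr (by nlinarith)
      nlinarith
    rw [abs_le]
    constructor <;> nlinarith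
  have hincr : Tendsto (fun T : ℝ => T⁻¹ * ((normSq (fun j => a j T) - normSq (fun j => a j 0)) / 2))
      atTop (𝓝 0) := by
    set M : ℝ := 2 * D₀ + 2 * normSq α + normSq (fun j => a j 0) with hM
    have hM0 : 0 ≤ M := by
      have : 0 ≤ normSq α := tsum_nonneg fun j => sq_nonneg _
      have : 0 ≤ normSq (fun j => a j 0) := tsum_nonneg fun j => sq_nonneg _
      positivity
    have hinv : Tendsto (fun T : ℝ => M / 2 * T⁻¹) atTop (𝓝 0) := by
      simpa using tendsto_inv_atTop_zero.const_mul (M / 2)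
    refine squeeze_zero_norm' ?_ hinv
    filter_upwards [eventually_gt_atTop (0 : ℝ)] with T hT
    rw [Real.norm_eq_abs, abs_mul, abs_of_pos (inv_pos.mpr hT), abs_div, abs_two]
    have := hbound T hT.le
    have hTi : 0 ≤ T⁻¹ := (inv_pos.mpr hT).le
    calc T⁻¹ * (|normSq (fun j => a j T) - normSq (fun j => a j 0)| / 2)
        ≤ T⁻¹ * (M / 2) := mul_le_mul_of_nonneg_left (by linarith) hTi
      _ = M / 2 * T⁻¹ := by ring
  have := hces.sub hincr
  simpa [mul_sub] using this


end AllExponents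

end Literature.Analysis.FluidPDE.CheskidovFriedlander2009

end
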